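import Literature.RepresentationTheory.HeisenbergGroup.SchrodingerConjugate
import HarnessLib

/-!
# Conjugate implementers for Gram-matrix pairings: `ρ_{-J}` versus `ρ_J`

Topic `RepresentationTheory/HeisenbergGroup`; namespace `Literature.RepresentationTheory.HeisenbergGroup`.  KERNEL ONLY
(theorems; no definition, no named fact).

`SchrodingerConjugate.lean` proves that complex conjugation carries the smooth Schrödinger model of a pairing `β` to
that of the OPPOSITE pairing, typed literally as `-β` (`implements_conjOp`, `conjOp_mem_MpPsi`).  The doubled local
models of the cell are Gram-matrix models `schrodingerSB (Matrix.toLinearMap₂' R T) ψ hl hb`, and the opposite space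
appears there as the Gram matrix `-T`, i.e. as the pairing `Matrix.toLinearMap₂' R (-T)` — equal, but not
syntactically equal, to `-(Matrix.toLinearMap₂' R T)`.  This file is the bridge:

* §1 transport along an equality of pairings `β' = -β` (proved by `subst`): the symplectic groups agree
  (`mem_symplecticGroup_iff_of_eq_neg`), and **`implements_conjOp_of_eq_neg`** (cast-free form: any `s'` over `β'`
  with `s'.σ = s.σ`, `s'.f = -s.f`), **`implements_conjOp_ofSymplectic_of_eq_neg`** (Weil's sections:
  `Implements ρ_β (ofSymplectic g) M → Implements ρ_{β'} (ofSymplectic ⟨g, _⟩) (conjOp M)`),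
  `conjOp_mem_MpPsi_of_eq_neg`; `conjOp` is an involution (`conjOp_conjOp`), so all of these are equivalences
  (`implements_conjOp_ofSymplectic_iff_of_eq_neg`);
* §2 the Gram-matrix specialisation `β = Matrix.toLinearMap₂' R J`, `β' = Matrix.toLinearMap₂' R (-J)`
  (`toLinearMap₂'_neg`): `mem_symplecticGroup_gram_neg_iff`, `continuous_toLinearMap₂'_neg_left`,
  **`implements_conjOp_ofSymplectic_gram`** / `…_gram'` (membership proof supplied) / `…_gram_symm` (from `-J` back
  to `J`), `conjOp_mem_MpPsi_gram`, `implements_conjOp_gram` (general `s`, cast-free form).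

Written for the cell `hodgecm-mathlib` (fan B, rung B-IV, KEY `b4-howe-compact-irreducible`, helper H14 = node E9 of
the doubling proof: in `MetaplecticSumStrippingRight.implements_of_boxSB` the second block is `T₂ = -T_v` and its
implementer is `conjOp` of the first block's).  Nothing about theta lifts is asserted here.

## References
* [MoeglinVignerasWaldspurger1987] C. Mœglin, M.-F. Vignéras, J.-L. Waldspurger, LNM 1291 (1987), Chap. 2 II.1 (A)
  and Remarque; Chap. 4 II.1 (the Weil representation of `W⁻ = (W, -⟨,⟩)`).
* [HarrisKudlaSweet1996] M. Harris, S. Kudla, W. Sweet, J. AMS 9 (1996), §1 (1.4).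
* [Weil1964] A. Weil, Acta Math. 111 (1964), Chap. I n° 5.
-/

set_option autoImplicit false

open Literature.NumberTheory.Automorphic (SchwartzBruhat)

namespace Literature.RepresentationTheory.HeisenbergGroup

universe u v

/-! ## §0 `conjOp` is an involution -/

section Involution

variable {X : Type v} [TopologicalSpace X]

/-- `conj ∘ (conj ∘ M ∘ conj) ∘ conj = M`. [cite: MoeglinVignerasWaldspurger1987, Chap. 2 II.1 (A)] -/
@[simp] theorem conjOp_conjOp (M : SchwartzBruhat X ≃ₗ[ℂ] SchwartzBruhat X) : conjOp (conjOp M) = M := by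
  apply LinearEquiv.ext
  intro f
  simp

end Involution

/-! ## §1 Transport along an equality of pairings `β' = -β` -/

section EqNeg

variable {R : Type u} [CommRing R] {X Y : Type v} [AddCommGroup X] [Module R X] [AddCommGroup Y] [Module R Y]
  {β β' : X →ₗ[R] Y →ₗ[R] R}

/-- the symplectic groups of `polar β'` and `polar β` have the same elements when `β' = -β`.
[cite: Weil1964, n° 5, p. 150] -/
theorem mem_symplecticGroup_iff_of_eq_neg (hβ' : β' = -β) (g : (X × Y) ≃ₗ[R] (X × Y)) :
    g ∈ symplecticGroup (polar β') ↔ g ∈ symplecticGroup (polar β) := by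
  subst hβ'
  exact mem_symplecticGroup_neg_iff β g

/-- Weil's sections over `polar β` and `polar β'` (`β' = -β`) have the same linear part and opposite quadratic
parts: `(ofSymplectic (polar β') ⟨g, _⟩).f w = -(ofSymplectic (polar β) g).f w`.
[cite: Weil1964, n° 5, pp. 150–151] -/
theorem ofSymplectic_f_of_eq_neg [Invertible (2 : R)] (hβ' : β' = -β) (g : symplecticGroup (polar β))
    (hg' : g.1 ∈ symplecticGroup (polar β')) (w : X × Y) :
    (ofSymplectic (polar β') ⟨g.1, hg'⟩).f w = -(ofSymplectic (polar β) g).f w := by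
  subst hβ'
  rw [show (⟨g.1, hg'⟩ : symplecticGroup (polar (-β))) = symplecticGroupNegEquiv β g from rfl,
    ← Heisenberg.PseudoSymplectic.negPolar_ofSymplectic, Heisenberg.PseudoSymplectic.negPolar_f]

variable [TopologicalSpace R] [ContinuousNeg R] [TopologicalSpace X] [IsTopologicalAddGroup X]
  {ψ : AddChar R Circle} (hl : IsLocallyConstant (⇑ψ : R → Circle))
  (hb : ∀ y : Y, Continuous fun u : X => β u y) (hb' : ∀ y : Y, Continuous fun u : X => β' u y)

/-- **conjugate implementers along `β' = -β`** (cast-free form): if `M` implements `s` on `ρ_β` and `s'` over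
`polar β'` has the same linear part and the opposite quadratic part (`s' = negPolar β s` read over `β'`), then
`conj ∘ M ∘ conj` implements `s'` on `ρ_{β'}`. [cite: MoeglinVignerasWaldspurger1987, Chap. 2 II.1 (A)] -/
theorem implements_conjOp_of_eq_neg (hβ' : β' = -β) {s : Heisenberg.PseudoSymplectic (polar β)}
    {s' : Heisenberg.PseudoSymplectic (polar β')} (hσ : s'.σ = s.σ) (hf : ∀ w, s'.f w = -s.f w)
    {M : SchwartzBruhat X ≃ₗ[ℂ] SchwartzBruhat X} (hM : Implements (schrodingerSB β ψ hl hb) s M) :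
    Implements (schrodingerSB β' ψ hl hb') s' (conjOp M) := by
  subst hβ'
  obtain rfl : s' = Heisenberg.PseudoSymplectic.negPolar β s :=
    Heisenberg.PseudoSymplectic.ext hσ (funext hf)
  exact implements_conjOp hl hb hM

/-- **conjugate implementers along `β' = -β`, Weil's sections**: if `M` implements `ofSymplectic (polar β) g` on
`ρ_β`, then `conj ∘ M ∘ conj` implements `ofSymplectic (polar β') ⟨g, _⟩` on `ρ_{β'}` (same symplectic element).
[cite: MoeglinVignerasWaldspurger1987, Chap. 2 II.1 (A)] -/
theorem implements_conjOp_ofSymplectic_of_eq_neg [Invertible (2 : R)] (hβ' : β' = -β)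
    {g : symplecticGroup (polar β)} (hg' : g.1 ∈ symplecticGroup (polar β'))
    {M : SchwartzBruhat X ≃ₗ[ℂ] SchwartzBruhat X}
    (hM : Implements (schrodingerSB β ψ hl hb) (ofSymplectic (polar β) g) M) :
    Implements (schrodingerSB β' ψ hl hb') (ofSymplectic (polar β') ⟨g.1, hg'⟩) (conjOp M) :=
  implements_conjOp_of_eq_neg hl hb hb' hβ' rfl (ofSymplectic_f_of_eq_neg hβ' g hg') hM

/-- … and conversely (`conjOp` is an involution and `-(-β) = β`): **`M` implements `g` on `ρ_β` iff
`conj ∘ M ∘ conj` implements `g` on `ρ_{β'}`**. [cite: MoeglinVignerasWaldspurger1987, Chap. 2 II.1 (A)] -/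
theorem implements_conjOp_ofSymplectic_iff_of_eq_neg [Invertible (2 : R)] (hβ' : β' = -β)
    {g : symplecticGroup (polar β)} (hg' : g.1 ∈ symplecticGroup (polar β'))
    (M : SchwartzBruhat X ≃ₗ[ℂ] SchwartzBruhat X) :
    Implements (schrodingerSB β' ψ hl hb') (ofSymplectic (polar β') ⟨g.1, hg'⟩) (conjOp M) ↔
      Implements (schrodingerSB β ψ hl hb) (ofSymplectic (polar β) g) M := by
  refine ⟨fun h => ?_, implements_conjOp_ofSymplectic_of_eq_neg hl hb hb' hβ' hg'⟩
  have hβ : β = -β' := (neg_eq_iff_eq_neg (a := β) (b := β')).mp hβ'.symm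
  have h' := implements_conjOp_ofSymplectic_of_eq_neg hl hb' hb hβ (g := ⟨g.1, hg'⟩) g.2 h
  rwa [conjOp_conjOp] at h'

/-- **at the level of MVW's groups of pairs**: `(g, M) ∈ S̃p_ψ(β) → (g, conj ∘ M ∘ conj) ∈ S̃p_ψ(β')` for
`β' = -β`. [cite: MoeglinVignerasWaldspurger1987, Chap. 2 II.1 (A)] -/
theorem conjOp_mem_MpPsi_of_eq_neg [Invertible (2 : R)] (hβ' : β' = -β) {g : symplecticGroup (polar β)}
    (hg' : g.1 ∈ symplecticGroup (polar β')) {M : SchwartzBruhat X ≃ₗ[ℂ] SchwartzBruhat X}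
    (hM : (g, M) ∈ MpPsi (schrodingerSB β ψ hl hb)) :
    ((⟨g.1, hg'⟩ : symplecticGroup (polar β')), conjOp M) ∈ MpPsi (schrodingerSB β' ψ hl hb') := by
  rw [mem_MpPsi] at hM ⊢
  exact implements_conjOp_ofSymplectic_of_eq_neg hl hb hb' hβ' hg' hM

end EqNeg

/-! ## §2 Gram matrices: `ρ_{-J}` versus `ρ_J` -/

section Gram

variable {R : Type u} [CommRing R] {ι : Type v} [Fintype ι] [DecidableEq ι]

/-- `Matrix.toLinearMap₂' R (-J) = -(Matrix.toLinearMap₂' R J)` (linearity of `Matrix.toLinearMap₂'`).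
[cite: MoeglinVignerasWaldspurger1987, Chap. 2 II.1 Remarque] -/
theorem toLinearMap₂'_neg (J : Matrix ι ι R) :
    (Matrix.toLinearMap₂' R (-J) : (ι → R) →ₗ[R] (ι → R) →ₗ[R] R) = -Matrix.toLinearMap₂' R J :=
  map_neg (Matrix.toLinearMap₂' R : Matrix ι ι R ≃ₗ[R] (ι → R) →ₗ[R] (ι → R) →ₗ[R] R) J

/-- the symplectic groups of the Gram pairings of `-J` and `J` have the same elements.
[cite: Weil1964, n° 5, p. 150] -/
theorem mem_symplecticGroup_gram_neg_iff (J : Matrix ι ι R)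
    (g : ((ι → R) × (ι → R)) ≃ₗ[R] ((ι → R) × (ι → R))) :
    g ∈ symplecticGroup (polar (Matrix.toLinearMap₂' R (-J))) ↔
      g ∈ symplecticGroup (polar (Matrix.toLinearMap₂' R J)) :=
  mem_symplecticGroup_iff_of_eq_neg (toLinearMap₂'_neg J) g

variable [TopologicalSpace R] [IsTopologicalAddGroup R] {ψ : AddChar R Circle}
  (hl : IsLocallyConstant (⇑ψ : R → Circle)) {J : Matrix ι ι R}
  (hb : ∀ y : ι → R, Continuous fun u : ι → R => Matrix.toLinearMap₂' R J u y)
  (hb' : ∀ y : ι → R, Continuous fun u : ι → R => Matrix.toLinearMap₂' R (-J) u y)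

include hb in
/-- continuity of `u ↦ ⟨u, y⟩_{-J}` from that of `u ↦ ⟨u, y⟩_J` (a continuity witness for `schrodingerSB … (-J)`).
[cite: MoeglinVignerasWaldspurger1987, Chap. 2 I.4 Exemple (1)] -/
theorem continuous_toLinearMap₂'_neg_left (y : ι → R) :
    Continuous fun u : ι → R => Matrix.toLinearMap₂' R (-J) u y := by
  simp only [toLinearMap₂'_neg, LinearMap.neg_apply]
  exact (hb y).neg

/-- **Gram form, general `s`** (cast-free): `M` implements `s` on `ρ_J` and `s'` over the Gram pairing of `-J` has
`s'.σ = s.σ`, `s'.f = -s.f` ⟹ `conj ∘ M ∘ conj` implements `s'` on `ρ_{-J}`.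
[cite: MoeglinVignerasWaldspurger1987, Chap. 2 II.1 (A)] -/
theorem implements_conjOp_gram {s : Heisenberg.PseudoSymplectic (polar (Matrix.toLinearMap₂' R J))}
    {s' : Heisenberg.PseudoSymplectic (polar (Matrix.toLinearMap₂' R (-J)))} (hσ : s'.σ = s.σ)
    (hf : ∀ w, s'.f w = -s.f w) {M : SchwartzBruhat (ι → R) ≃ₗ[ℂ] SchwartzBruhat (ι → R)}
    (hM : Implements (schrodingerSB (Matrix.toLinearMap₂' R J) ψ hl hb) s M) :
    Implements (schrodingerSB (Matrix.toLinearMap₂' R (-J)) ψ hl hb') s' (conjOp M) :=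
  implements_conjOp_of_eq_neg hl hb hb' (toLinearMap₂'_neg J) hσ hf hM

/-- **Gram form, Weil's sections**: if `M` implements `ofSymplectic _ g` on
`ρ_J = schrodingerSB (toLinearMap₂' R J) ψ`, then `conjOp M = conj ∘ M ∘ conj` implements `ofSymplectic _ ⟨g, hg'⟩` on
`ρ_{-J} = schrodingerSB (toLinearMap₂' R (-J)) ψ` (any membership witness `hg'`, e.g.
`(mem_symplecticGroup_gram_neg_iff J g.1).2 g.2`).
[cite: MoeglinVignerasWaldspurger1987, Chap. 2 II.1 (A); Chap. 4 II.1] -/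
theorem implements_conjOp_ofSymplectic_gram [Invertible (2 : R)]
    {g : symplecticGroup (polar (Matrix.toLinearMap₂' R J))}
    (hg' : g.1 ∈ symplecticGroup (polar (Matrix.toLinearMap₂' R (-J))))
    {M : SchwartzBruhat (ι → R) ≃ₗ[ℂ] SchwartzBruhat (ι → R)}
    (hM : Implements (schrodingerSB (Matrix.toLinearMap₂' R J) ψ hl hb) (ofSymplectic _ g) M) :
    Implements (schrodingerSB (Matrix.toLinearMap₂' R (-J)) ψ hl hb') (ofSymplectic _ ⟨g.1, hg'⟩) (conjOp M) :=
  implements_conjOp_ofSymplectic_of_eq_neg hl hb hb' (toLinearMap₂'_neg J) hg' hM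

/-- the same with the membership witness supplied.
[cite: MoeglinVignerasWaldspurger1987, Chap. 2 II.1 (A); Chap. 4 II.1] -/
theorem implements_conjOp_ofSymplectic_gram' [Invertible (2 : R)]
    {g : symplecticGroup (polar (Matrix.toLinearMap₂' R J))}
    {M : SchwartzBruhat (ι → R) ≃ₗ[ℂ] SchwartzBruhat (ι → R)}
    (hM : Implements (schrodingerSB (Matrix.toLinearMap₂' R J) ψ hl hb) (ofSymplectic _ g) M) :
    Implements (schrodingerSB (Matrix.toLinearMap₂' R (-J)) ψ hl hb')
      (ofSymplectic _ ⟨g.1, (mem_symplecticGroup_gram_neg_iff J g.1).2 g.2⟩) (conjOp M) :=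
  implements_conjOp_ofSymplectic_gram hl hb hb' _ hM

/-- **from `ρ_{-J}` back to `ρ_J`**: if `M` implements `ofSymplectic _ g` on `ρ_{-J}`, then `conjOp M` implements
`ofSymplectic _ ⟨g, hg⟩` on `ρ_J` (`-(-J) = J`).
[cite: MoeglinVignerasWaldspurger1987, Chap. 2 II.1 (A); Chap. 4 II.1] -/
theorem implements_conjOp_ofSymplectic_gram_symm [Invertible (2 : R)]
    {g : symplecticGroup (polar (Matrix.toLinearMap₂' R (-J)))}
    (hg : g.1 ∈ symplecticGroup (polar (Matrix.toLinearMap₂' R J)))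
    {M : SchwartzBruhat (ι → R) ≃ₗ[ℂ] SchwartzBruhat (ι → R)}
    (hM : Implements (schrodingerSB (Matrix.toLinearMap₂' R (-J)) ψ hl hb') (ofSymplectic _ g) M) :
    Implements (schrodingerSB (Matrix.toLinearMap₂' R J) ψ hl hb) (ofSymplectic _ ⟨g.1, hg⟩) (conjOp M) :=
  implements_conjOp_ofSymplectic_of_eq_neg hl hb' hb
    ((neg_eq_iff_eq_neg (a := (Matrix.toLinearMap₂' R J : (ι → R) →ₗ[R] (ι → R) →ₗ[R] R))
      (b := Matrix.toLinearMap₂' R (-J))).mp (toLinearMap₂'_neg J).symm) hg hM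

/-- **equivalence**: `conjOp M` implements `g` on `ρ_{-J}` iff `M` implements `g` on `ρ_J`.
[cite: MoeglinVignerasWaldspurger1987, Chap. 2 II.1 (A); Chap. 4 II.1] -/
theorem implements_conjOp_ofSymplectic_gram_iff [Invertible (2 : R)]
    {g : symplecticGroup (polar (Matrix.toLinearMap₂' R J))}
    (hg' : g.1 ∈ symplecticGroup (polar (Matrix.toLinearMap₂' R (-J))))
    (M : SchwartzBruhat (ι → R) ≃ₗ[ℂ] SchwartzBruhat (ι → R)) :
    Implements (schrodingerSB (Matrix.toLinearMap₂' R (-J)) ψ hl hb') (ofSymplectic _ ⟨g.1, hg'⟩) (conjOp M) ↔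
      Implements (schrodingerSB (Matrix.toLinearMap₂' R J) ψ hl hb) (ofSymplectic _ g) M :=
  implements_conjOp_ofSymplectic_iff_of_eq_neg hl hb hb' (toLinearMap₂'_neg J) hg' M

/-- **MVW's groups of pairs, Gram form**: `(g, M) ∈ S̃p_ψ(J) → (g, conj ∘ M ∘ conj) ∈ S̃p_ψ(-J)`.
[cite: MoeglinVignerasWaldspurger1987, Chap. 2 II.1 (A); Chap. 4 II.1] -/
theorem conjOp_mem_MpPsi_gram [Invertible (2 : R)] {g : symplecticGroup (polar (Matrix.toLinearMap₂' R J))}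
    (hg' : g.1 ∈ symplecticGroup (polar (Matrix.toLinearMap₂' R (-J))))
    {M : SchwartzBruhat (ι → R) ≃ₗ[ℂ] SchwartzBruhat (ι → R)}
    (hM : (g, M) ∈ MpPsi (schrodingerSB (Matrix.toLinearMap₂' R J) ψ hl hb)) :
    ((⟨g.1, hg'⟩ : symplecticGroup (polar (Matrix.toLinearMap₂' R (-J)))), conjOp M) ∈
      MpPsi (schrodingerSB (Matrix.toLinearMap₂' R (-J)) ψ hl hb') :=
  conjOp_mem_MpPsi_of_eq_neg hl hb hb' (toLinearMap₂'_neg J) hg' hM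

end Gram

end Literature.RepresentationTheory.HeisenbergGroup
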